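import Literature.NumberTheory.Automorphic.UnitaryGroupLocalCentralizerMeasureSemisimple
import Literature.NumberTheory.Rogawski1990.AnisotropicUnitarySemisimple
import Literature.NumberTheory.Rogawski1990.RegularEltLocalisation
import Literature.NumberTheory.Rogawski1990.LocalTransferCertification
import Literature.NumberTheory.Rogawski1990.AdelicStableClassesProduct
import Literature.NumberTheory.Rogawski1990.AdelicStableClassSupportFiniteH
import Literature.NumberTheory.Automorphic.ArchCentralizerUnimodularOfAdelic
import Literature.NumberTheory.Rogawski1990.SingularLocalRealisation
import Literature.NumberTheory.Rogawski1990.SingularStableClassTransfers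
import Literature.NumberTheory.Rogawski1990.SingularArchRealisation
import Literature.NumberTheory.Rogawski1990.SingularClassOccursInAnisotropic
import Literature.NumberTheory.Rogawski1990.AdelicStableConjugacyG
import HarnessLib

/-!
# The PATCHED class-indexed families of the ENGINE T1 kit at the NON-REGULAR classes: admissibility on the local ∕ archimedean stable class,
# normalisation, and the tower point data — the anchors of pins (ix-adm), (ix-admA), (ix-admAq), (ix-norm) at singular and central `γ₀`
(Rogawski (1990), §4.3 pp. 43–44, §4.9 p. 54, §14.2 p. 232, §14.5 pp. 237–239; Kottwitz (1986), Prop. 7.1)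

Topic `NumberTheory/Automorphic`; namespace `Literature.NumberTheory.Automorphic.UnitaryGroup`; THEOREMS ONLY (no definition, no instance, no named fact,
no `sorry`).  Cell `pub/hodgecm-mathlib`, ENGINE T1 line `F0_T1InnerFormTraceIdentity` (crux item stmt-HodgeConjecture-24833), row (ANCHOR-s)∕(ANCHOR-∞q)
(O7 OWNER WORD #18 (2), LEAD O7 BOOK WORDS 2026-08-31T11:22:28Z, RULING #115 (F1′)): the ★ version of the HOME certificate `ANCHOR-s.cert.v4`.

THE PATCH.  The T1 line pins its kit families `mG v`, `mGi`, `mqi` on the REGULAR classes only (canonicity ∕ admissibility ∕ normalisation there).  ED 1.24's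
anchor redefines them at the NON-regular classes: `mG′ v c := if IsRegularElt (out c) then mG v c else mG_s v c` (idem `mGi′`, `mqi′`), so that every
ED ≤ 1.23 conjunct (read at regular classes, or through Δ-weighted sums vanishing at singular classes) transfers along the agreement (P)∕(P∞), while the
singular-class riders come from the `else`-members.  §1 is MEMBER-GENERIC (what the riders need of ANY singular members `m_s`: admissibility at the
classes of the components of suitable rational points + LOCAL REALISATION (LR-s)∕(LR-∞) = every class of the local stable class of `(γ₀)_v` ∕ `γ₀ ⊗ 1`
contains such a component — ★ `Rogawski1990.SingularLocalRealisation` (finite places), B-p14's `SingularArchRealisation` (archimedean, consumed as a binder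
here)); §2 instantiates with the LEVEL-normalised members of ★ `UnitaryGroupLocalCentralizerMeasureSemisimple` and the arch families of ★
`ArchCentralizerUnimodularOfAdelic` (under RULING #115 (F1′) MAIN's `else`-branch takes instead the K7-s members of the singular package; §1 serves both).

* §1 `isNormalisedOff_congr_point`, `isAdmissibleOn_corresponds_of_forall_exists_isConj`, `isAdmissibleOn_corresponds_arch_of_forall_exists_isConj`.
* §2 **`exists_patchedFamilies_of_not_isRegularElt`** (finite + `G′_∞`; `hadm′`, `hnormγ′`, FILE-A point data unconditional, `hadmA′` modulo the (LR-∞)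
  and `hadmA′`, all unconditional) and **`exists_patchedArchFamily_quasiSplit_of_not_isRegularElt`** (`G_∞ = U(Φ₃)_∞`; `hadmAq` — all UNCONDITIONAL: (LR-s) ★ p821817, (LR-∞) ★ p822441).
HC_CM is proved only modulo the printed citations (7 + the (xv)∕(xv-s) package clauses) until rung 0 closes; this file proves no printed citation.

## References
* J. D. Rogawski, *Automorphic Representations of Unitary Groups in Three Variables* (1990), §4.3 pp. 43–44, §4.9 p. 54, §14.2 p. 232,
  §14.5 pp. 237–239 [Rogawski1990].
* R. E. Kottwitz, *Stable trace formula: elliptic singular terms*, Math. Ann. 275 (1986), Prop. 7.1 [Kottwitz1986].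
-/

set_option autoImplicit false

noncomputable section

open MeasureTheory Measure Set Topology NumberField IsDedekindDomain
open Literature.MeasureTheory.Group Literature.NumberTheory.Rogawski1990
open Literature.AlgebraicGeometry.ShimuraVarieties (hermForm unitaryGroup)
open scoped ENNReal NNReal Matrix MatrixGroups

namespace Literature.NumberTheory.Automorphic.UnitaryGroup

variable (L : Type) [Field L] [NumberField L] [IsCMField L] {H : Matrix (Fin 3) (Fin 3) L}

/-! ## §1 Member-generic riders: what the patch needs from the singular members (any `N`, any `H`) -/

section Generic

variable {N : ℕ} {H₀ : Matrix (Fin N) (Fin N) L}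
  [∀ (v : HeightOneSpectrum (𝓞 ↥(maximalRealSubfield L))) (x : (cmDatum L N H₀).Local v),
    MeasurableSpace ((cmDatum L N H₀).Local v ⧸ Subgroup.centralizer ({x} : Set ((cmDatum L N H₀).Local v)))]

/-- **`IsNormalisedOff` reads the local families only at the classes `⟦g_v⟧`**: two families with the same member at `⟦g_v⟧` for every `v` are normalised
at `g` off the same sets (★ `OrbitalMeasureFamily.atPoint` is the member at the class, transported). [cite: Rogawski1990, §4.3 p. 44] -/
theorem isNormalisedOff_congr_point (mG mG' : ∀ v : HeightOneSpectrum (𝓞 ↥(maximalRealSubfield L)), OrbitalMeasureFamily ((cmDatum L N H₀).Local v))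
    (g : (cmDatum L N H₀).Adelic) (S₀ : Finset (HeightOneSpectrum (𝓞 ↥(maximalRealSubfield L))))
    (h : ∀ v, mG' v (ConjClasses.mk ((cmDatum L N H₀).toLocal v g)) = mG v (ConjClasses.mk ((cmDatum L N H₀).toLocal v g)))
    (hS₀ : IsNormalisedOff L N H₀ mG g S₀) : IsNormalisedOff L N H₀ mG' g S₀ := fun v hv => by
  have hpt : (mG' v).atPoint ((cmDatum L N H₀).toLocal v g) = (mG v).atPoint ((cmDatum L N H₀).toLocal v g) := by
    unfold OrbitalMeasureFamily.atPoint
    rw [h v]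
  rw [hpt]
  exact hS₀ v hv

/-- **Admissibility of a patched family on the local stable class of a non-regular point, from LOCAL REALISATION** (member-generic): at a finite `v`, let
`g₀ ∈ U(H₀)(L⁺_v)` be non-regular, `m′` ANY family agreeing with `m_s` at the non-regular classes, `m_s` admissible at the class of `(δ)_v` for every
rational `δ` with `P δ`, and suppose every `x` corresponding to `g₀` is conjugate to some `(δ)_v` with `P δ` ((LR-s) shape).  Then `m′` is admissible on
`Corresponds_v g₀ ·` (a corresponding class is non-regular, ★ `isRegularElt_of_isConj`). [cite: Kottwitz1986, Prop. 7.1] [cite: Rogawski1990, §4.9 p. 54] -/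
theorem isAdmissibleOn_corresponds_of_forall_exists_isConj (v : HeightOneSpectrum (𝓞 ↥(maximalRealSubfield L)))
    (m' ms : OrbitalMeasureFamily ((cmDatum L N H₀).Local v)) (g₀ : (cmDatum L N H₀).Local v)
    (hnreg : ¬ IsRegularElt (g₀.val : GL (Fin N) (LocalRing L v)))
    (hagree : ∀ c : ConjClasses ((cmDatum L N H₀).Local v), ¬ IsRegularElt ((Quotient.out c).val : GL (Fin N) (LocalRing L v)) → m' c = ms c)
    (P : (cmDatum L N H₀).Rational → Prop)
    (hadm : ∀ δ : (cmDatum L N H₀).Rational, P δ →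
      ms (ConjClasses.mk ((cmDatum L N H₀).toLocal v ((cmDatum L N H₀).toAdelic δ))) ≠ 0 ∧
      SMulInvariantMeasure ((cmDatum L N H₀).Local v) _ (ms (ConjClasses.mk ((cmDatum L N H₀).toLocal v ((cmDatum L N H₀).toAdelic δ)))) ∧
      IsFiniteMeasureOnCompacts (ms (ConjClasses.mk ((cmDatum L N H₀).toLocal v ((cmDatum L N H₀).toAdelic δ)))))
    (hLR : ∀ x : (cmDatum L N H₀).Local v,
      Corresponds (conjLocal L (IsCMField.complexConj L) v) ((adelicForm L N H₀).map (adeleToLocal L v))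
        ((adelicForm L N H₀).map (adeleToLocal L v)) g₀ x →
      ∃ δ : (cmDatum L N H₀).Rational, P δ ∧ IsConj ((cmDatum L N H₀).toLocal v ((cmDatum L N H₀).toAdelic δ)) x) :
    m'.IsAdmissibleOn fun x : (cmDatum L N H₀).Local v =>
      Corresponds (conjLocal L (IsCMField.complexConj L) v) ((adelicForm L N H₀).map (adeleToLocal L v))
        ((adelicForm L N H₀).map (adeleToLocal L v)) g₀ x := by
  intro c hc
  have hcn : ¬ IsRegularElt ((Quotient.out c).val : GL (Fin N) (LocalRing L v)) :=
    fun h => hnreg (isRegularElt_of_isConj hc.symm h)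
  obtain ⟨δ, hPδ, hδ⟩ := hLR (Quotient.out c) hc
  have hcδ : ConjClasses.mk ((cmDatum L N H₀).toLocal v ((cmDatum L N H₀).toAdelic δ)) = c := by
    rw [ConjClasses.mk_eq_mk_iff_isConj.2 hδ, ← ConjClasses.quotient_mk_eq_mk, Quotient.out_eq]
  have h := hadm δ hPδ
  rw [hcδ] at h
  rw [hagree c hcn]
  exact h

variable {H₂ : Matrix (Fin N) (Fin N) L}
  [∀ a : arch (↥(maximalRealSubfield L)) L (IsCMField.complexConj L) N H₂,
    MeasurableSpace (arch (↥(maximalRealSubfield L)) L (IsCMField.complexConj L) N H₂ ⧸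
      Subgroup.centralizer ({a} : Set (arch (↥(maximalRealSubfield L)) L (IsCMField.complexConj L) N H₂)))]

omit [∀ (v : HeightOneSpectrum (𝓞 ↥(maximalRealSubfield L))) (x : (cmDatum L N H₀).Local v),
    MeasurableSpace ((cmDatum L N H₀).Local v ⧸ Subgroup.centralizer ({x} : Set ((cmDatum L N H₀).Local v)))] in
/-- **The archimedean twin** (two forms `H₀`, `H₂ ∈ M_N(L)`: `H₂ = H₀` for the inner form's own `G′_∞`, `H₂ = Φ_N` for the quasi-split side): a family `m′` on
`U(H₂)_∞` agreeing with `m_s` at the non-regular classes, `m_s` admissible at `⟦δ ⊗ 1⟧` for every rational `δ ∈ U(H₂)(L⁺)` with `P δ`, and the archimedean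
local realisation at the non-regular `g₀ ∈ U(H₀)_∞` ((LR-∞) shape) give admissibility of `m′` on `Corresponds_∞^{H₀,H₂} g₀ ·`.
[cite: Rogawski1990, §14.2 p. 232; §4.9 p. 54] -/
theorem isAdmissibleOn_corresponds_arch_of_forall_exists_isConj
    (m' ms : OrbitalMeasureFamily (arch (↥(maximalRealSubfield L)) L (IsCMField.complexConj L) N H₂))
    (g₀ : arch (↥(maximalRealSubfield L)) L (IsCMField.complexConj L) N H₀)
    (hnreg : ¬ IsRegularElt (g₀.val : GL (Fin N) (mixedEmbedding.mixedSpace L)))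
    (hagree : ∀ c : ConjClasses (arch (↥(maximalRealSubfield L)) L (IsCMField.complexConj L) N H₂),
      ¬ IsRegularElt ((Quotient.out c).val : GL (Fin N) (mixedEmbedding.mixedSpace L)) → m' c = ms c)
    (P : (cmDatum L N H₂).Rational → Prop)
    (hadm : ∀ δ : (cmDatum L N H₂).Rational, P δ →
      ms (ConjClasses.mk (cmRationalToArch L N H₂ δ)) ≠ 0 ∧
      SMulInvariantMeasure (arch (↥(maximalRealSubfield L)) L (IsCMField.complexConj L) N H₂) _ (ms (ConjClasses.mk (cmRationalToArch L N H₂ δ))) ∧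
      IsFiniteMeasureOnCompacts (ms (ConjClasses.mk (cmRationalToArch L N H₂ δ))))
    (hLR : ∀ x : arch (↥(maximalRealSubfield L)) L (IsCMField.complexConj L) N H₂,
      Corresponds (conjMixed (↥(maximalRealSubfield L)) L (IsCMField.complexConj L)) (archFormOf L N H₀) (archFormOf L N H₂) g₀ x →
      ∃ δ : (cmDatum L N H₂).Rational, P δ ∧ IsConj (cmRationalToArch L N H₂ δ) x) :
    m'.IsAdmissibleOn fun x : arch (↥(maximalRealSubfield L)) L (IsCMField.complexConj L) N H₂ =>
      Corresponds (conjMixed (↥(maximalRealSubfield L)) L (IsCMField.complexConj L)) (archFormOf L N H₀) (archFormOf L N H₂) g₀ x := by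
  intro c hc
  have hcn : ¬ IsRegularElt ((Quotient.out c).val : GL (Fin N) (mixedEmbedding.mixedSpace L)) :=
    fun h => hnreg (isRegularElt_of_isConj hc.symm h)
  obtain ⟨δ, hPδ, hδ⟩ := hLR (Quotient.out c) hc
  have hcδ : ConjClasses.mk (cmRationalToArch L N H₂ δ) = c := by
    rw [ConjClasses.mk_eq_mk_iff_isConj.2 hδ, ← ConjClasses.quotient_mk_eq_mk, Quotient.out_eq]
  have h := hadm δ hPδ
  rw [hcδ] at h
  rw [hagree c hcn]
  exact h

end Generic

/-! ## §2 The patched families at a non-regular class of the anisotropic `U(H)`, `N = 3` (level members as default witnesses) -/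

/-- **THE PATCHED KIT FAMILIES AT A NON-REGULAR CLASS (finite places + `G′_∞`).**  `H` anisotropic, `N = 3`; `ν_v` two-sided Haar with `ν_v(K_v) = 1`; the kit's
class-indexed families `mG v`, `mGi` (any); `γ₀` a NON-regular rational element; (LR-s)∕(LR-∞) ★ `SingularLocalRealisation` ∕ `SingularArchRealisation` inside.
THEN the dite-patched families `mG′ v c := if IsRegularElt (out c) then mG v c else mG_s v c` (`mG_s` = ★ level-normalised members) and `mGi′` (patched by ★
`exists_archOrbitalMeasureFamily_of_anisotropic`) satisfy: (P∞)∕(P) agreement with the kit at every REGULAR class; `hadmA′` = (ix-admA) at `γ₀` (via ★ (LR-∞) `exists_isStablyConj_and_isConj_arch_of_isConj_arch`);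
`hadm′` = (ix-adm) at `γ₀` (via ★ (LR-s) `forall_exists_isStablyConj_and_isConj_toLocal_of_mul_sub_eq_zero`); `hnormγ′` = (ix-norm) at `γ₀`; and the point data
`(S₀, t, hat, hadm, ht1K)` of ★ `exists_tower_ofLocal_eq_quotientMeasure_of_atPoint_eq` at `γ₀` — binder spellings = ★ (SA-st)
`adelicStableOrbitalSum_classesSelf_eq_adelicStableOrbitalIntegralG_of_mul_sub_eq_zero` :128–:141 VERBATIM.
[cite: Rogawski1990, §4.3 pp. 43–44; §4.9 p. 54; §14.5 pp. 237–239] [cite: Kottwitz1986, Prop. 7.1] -/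
theorem exists_patchedFamilies_of_not_isRegularElt (hanis : ∀ x : Fin 3 → L, hermForm (cmConjRingHom L) H x x = 0 → x = 0)
    (hH : (H.map (cmConjRingHom L))ᵀ = H) (hdet : H.det ≠ 0)
    [∀ v, MeasurableSpace ((cmDatum L 3 H).Local v)] [∀ v, BorelSpace ((cmDatum L 3 H).Local v)]
    [∀ (v : HeightOneSpectrum (𝓞 ↥(maximalRealSubfield L))) (g : (cmDatum L 3 H).Local v),
      MeasurableSpace (((cmDatum L 3 H).Local v) ⧸ Subgroup.centralizer ({g} : Set ((cmDatum L 3 H).Local v)))]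
    [∀ (v : HeightOneSpectrum (𝓞 ↥(maximalRealSubfield L))) (g : (cmDatum L 3 H).Local v),
      BorelSpace (((cmDatum L 3 H).Local v) ⧸ Subgroup.centralizer ({g} : Set ((cmDatum L 3 H).Local v)))]
    (ν : ∀ v, Measure ((cmDatum L 3 H).Local v)) [∀ v, (ν v).IsHaarMeasure] [∀ v, (ν v).IsMulRightInvariant]
    (hK : ∀ v, ν v (cmLocalIntegralLevel L 3 H v : Set ((cmDatum L 3 H).Local v)) = 1)
    (mG : ∀ v : HeightOneSpectrum (𝓞 ↥(maximalRealSubfield L)), OrbitalMeasureFamily ((cmDatum L 3 H).Local v))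
    [MeasurableSpace (arch (↥(maximalRealSubfield L)) L (IsCMField.complexConj L) 3 H)] [BorelSpace (arch (↥(maximalRealSubfield L)) L (IsCMField.complexConj L) 3 H)]
    [∀ a : arch (↥(maximalRealSubfield L)) L (IsCMField.complexConj L) 3 H,
      MeasurableSpace (arch (↥(maximalRealSubfield L)) L (IsCMField.complexConj L) 3 H ⧸ Subgroup.centralizer ({a} : Set (arch (↥(maximalRealSubfield L)) L (IsCMField.complexConj L) 3 H)))]
    [∀ a : arch (↥(maximalRealSubfield L)) L (IsCMField.complexConj L) 3 H,
      BorelSpace (arch (↥(maximalRealSubfield L)) L (IsCMField.complexConj L) 3 H ⧸ Subgroup.centralizer ({a} : Set (arch (↥(maximalRealSubfield L)) L (IsCMField.complexConj L) 3 H)))]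
    (mGi : OrbitalMeasureFamily (arch (↥(maximalRealSubfield L)) L (IsCMField.complexConj L) 3 H))
    (γ₀ : (cmDatum L 3 H).Rational) (hnreg : ¬ IsRegularElt (γ₀.val : GL (Fin 3) L)) :
    ∃ (mG' : ∀ v : HeightOneSpectrum (𝓞 ↥(maximalRealSubfield L)), OrbitalMeasureFamily ((cmDatum L 3 H).Local v))
      (mGi' : OrbitalMeasureFamily (arch (↥(maximalRealSubfield L)) L (IsCMField.complexConj L) 3 H)),
      -- (P∞) the arch patch agrees with the kit family at every REGULAR arch class
      (∀ c : ConjClasses (arch (↥(maximalRealSubfield L)) L (IsCMField.complexConj L) 3 H),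
        IsRegularElt ((Quotient.out c).val : GL (Fin 3) (mixedEmbedding.mixedSpace L)) → mGi' c = mGi c) ∧
      -- `hadmA′` of ★ (SA-st) :133 VERBATIM (for `mGi′`)
      (mGi'.IsAdmissibleOn fun x : arch (↥(maximalRealSubfield L)) L (IsCMField.complexConj L) 3 H =>
        Corresponds (conjMixed (↥(maximalRealSubfield L)) L (IsCMField.complexConj L)) (archFormOf L 3 H) (archFormOf L 3 H) (cmRationalToArch L 3 H γ₀) x) ∧
      -- (P) the patch agrees with the kit family at every REGULAR local class
      (∀ v (c : ConjClasses ((cmDatum L 3 H).Local v)), IsRegularElt ((Quotient.out c).val : GL (Fin 3) (LocalRing L v)) → mG' v c = mG v c) ∧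
      -- `hadm′` of ★ (SA-st) :128 VERBATIM (for `mG′`)
      (∀ v, (mG' v).IsAdmissibleOn fun x : (cmDatum L 3 H).Local v =>
        Corresponds (conjLocal L (IsCMField.complexConj L) v) ((adelicForm L 3 H).map (adeleToLocal L v))
          ((adelicForm L 3 H).map (adeleToLocal L v)) ((cmDatum L 3 H).toLocal v ((cmDatum L 3 H).toAdelic γ₀)) x) ∧
      -- `hnormγ′` of ★ (SA-st) :138 VERBATIM (for `mG′`)
      (∃ S₀ : Finset (HeightOneSpectrum (𝓞 ↥(maximalRealSubfield L))), IsNormalisedOff L 3 H mG' ((cmDatum L 3 H).toAdelic γ₀) S₀) ∧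
      -- the point data of ★ FILE A at `γ₀` for `mG′`
      ∃ (S₀ : Finset (HeightOneSpectrum (𝓞 ↥(maximalRealSubfield L))))
        (t : ∀ v, Measure (Subgroup.centralizer ({(cmDatum L 3 H).toLocal v ((cmDatum L 3 H).toAdelic γ₀)} : Set ((cmDatum L 3 H).Local v)))),
        ∃ (_ : ∀ v, (t v).IsHaarMeasure) (_ : ∀ v, (t v).IsInvInvariant),
          (∀ v, (mG' v).atPoint ((cmDatum L 3 H).toLocal v ((cmDatum L 3 H).toAdelic γ₀)) =
            quotientMeasure (Subgroup.centralizer ({(cmDatum L 3 H).toLocal v ((cmDatum L 3 H).toAdelic γ₀)} : Set ((cmDatum L 3 H).Local v)))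
              (t v) (isClosed_coe_centralizer_singleton _) (ν v)) ∧
          (∀ v, mG' v (ConjClasses.mk ((cmDatum L 3 H).toLocal v ((cmDatum L 3 H).toAdelic γ₀))) ≠ 0 ∧
            SMulInvariantMeasure ((cmDatum L 3 H).Local v) _ (mG' v (ConjClasses.mk ((cmDatum L 3 H).toLocal v ((cmDatum L 3 H).toAdelic γ₀)))) ∧
            IsFiniteMeasureOnCompacts (mG' v (ConjClasses.mk ((cmDatum L 3 H).toLocal v ((cmDatum L 3 H).toAdelic γ₀))))) ∧
          ∀ v, v ∉ S₀ → t v (Subtype.val ⁻¹' (cmLocalIntegralLevel L 3 H v : Set ((cmDatum L 3 H).Local v))) = 1 := by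
  classical
  have hss : ∀ δ : (cmDatum L 3 H).Rational, Rogawski1990.IsSemisimpleElt (cmConjRingHom L) H δ :=
    fun δ => isSemisimpleElt_of_anisotropic (cmConjRingHom L) H hanis δ
  -- ★ (LR-s): every local class corresponding to `(γ₀)_v` contains the component of a rational `δ` (p08 (g6), p821817)
  obtain ⟨a, b, hab, -, -, hγab⟩ := exists_ne_mul_sub_eq_zero_of_isSemisimpleElt_of_not_isRegularElt_cm L hH hdet γ₀ (hss γ₀) hnreg
  have hLR := forall_exists_isStablyConj_and_isConj_toLocal_of_mul_sub_eq_zero hH hdet hab hγab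
  -- ★ (LR-∞): every archimedean class corresponding to `γ₀ ⊗ 1` contains some rational `δ ⊗ 1` (B-p14 (g25), p822441)
  have hLRi : ∀ (x : arch (↥(maximalRealSubfield L)) L (IsCMField.complexConj L) 3 H),
      Corresponds (conjMixed (↥(maximalRealSubfield L)) L (IsCMField.complexConj L)) (archFormOf L 3 H) (archFormOf L 3 H) (cmRationalToArch L 3 H γ₀) x →
      ∃ δ : (cmDatum L 3 H).Rational, IsStablyConj (cmConjRingHom L) H γ₀ δ ∧ IsConj (cmRationalToArch L 3 H δ) x :=
    fun x hx => exists_isStablyConj_and_isConj_arch_of_isConj_arch hH hdet hab γ₀ hγab x hx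
  -- `(γ₀)_v` is not regular (regularity descends along the injective `L → L ⊗ L⁺_v`, `Polynomial.separable_map`)
  have hnregv : ∀ v, ¬ IsRegularElt ((((cmDatum L 3 H).toLocal v ((cmDatum L 3 H).toAdelic γ₀))).val : GL (Fin 3) (LocalRing L v)) := by
    intro v h
    apply hnreg
    rw [isRegularElt_iff] at h ⊢
    rw [coe_cmDatum_toLocal_toAdelic, coe_toLocalGL_apply, Matrix.charpoly_map] at h
    exact (Polynomial.separable_map _).1 h
  -- `γ₀ ⊗ 1` is not regular at `∞` either (★ `charpoly_cmRationalToArch_eq_map` + `Polynomial.separable_map`)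
  have hnregi : ¬ IsRegularElt ((cmRationalToArch L 3 H γ₀).val : GL (Fin 3) (mixedEmbedding.mixedSpace L)) := by
    intro h
    apply hnreg
    rw [isRegularElt_iff] at h ⊢
    rw [charpoly_cmRationalToArch_eq_map] at h
    exact (Polynomial.separable_map _).1 h
  -- ★ the archimedean family at the classes through rational points
  obtain ⟨mGis, hmGis⟩ := exists_archOrbitalMeasureFamily_of_anisotropic L H hanis hH hdet
  -- ★ B: the level-normalised families at the semisimple classes
  obtain ⟨mGs, hmGs⟩ := exists_localOrbitalMeasureFamilies_levelNormalised_of_isSemisimpleElt L hH hdet ν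
  refine ⟨fun v c => if IsRegularElt ((Quotient.out c).val : GL (Fin 3) (LocalRing L v)) then mG v c else mGs v c,
    fun c => if IsRegularElt ((Quotient.out c).val : GL (Fin 3) (mixedEmbedding.mixedSpace L)) then mGi c else mGis c,
    fun c hc => if_pos hc, ?_, fun v c hc => if_pos hc, ?_, ?_, ?_⟩
  · -- hadmA′ (modulo hLR∞)
    intro c hc
    have hcn : ¬ IsRegularElt ((Quotient.out c).val : GL (Fin 3) (mixedEmbedding.mixedSpace L)) :=
      fun h => hnregi (isRegularElt_of_isConj hc.symm h)
    obtain ⟨δ, -, hδ⟩ := hLRi (Quotient.out c) hc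
    have hcδ : ConjClasses.mk (cmRationalToArch L 3 H δ) = c := by
      rw [ConjClasses.mk_eq_mk_iff_isConj.2 hδ, ← ConjClasses.quotient_mk_eq_mk, Quotient.out_eq]
    obtain ⟨h0, hinv, -, hfin⟩ := hmGis c ⟨δ, hcδ⟩
    simp only [if_neg hcn]
    exact ⟨h0, hinv, hfin⟩
  · -- hadm′ (via ★ (LR-s))
    intro v c hc
    have hcn : ¬ IsRegularElt ((Quotient.out c).val : GL (Fin 3) (LocalRing L v)) :=
      fun h => hnregv v (isRegularElt_of_isConj hc.symm h)
    obtain ⟨δ, -, hδ⟩ := hLR v (Quotient.out c) hc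
    have hcδ : ConjClasses.mk ((cmDatum L 3 H).toLocal v ((cmDatum L 3 H).toAdelic δ)) = c := by
      rw [ConjClasses.mk_eq_mk_iff_isConj.2 hδ, ← ConjClasses.quotient_mk_eq_mk, Quotient.out_eq]
    obtain ⟨hadm, -⟩ := hmGs δ (hss δ)
    have h := hadm v
    rw [hcδ] at h
    simp only [if_neg hcn]
    exact h
  · -- hnormγ′
    obtain ⟨-, S₀, t, htH, htI, hat, ht1⟩ := hmGs γ₀ (hss γ₀)
    refine ⟨S₀, fun v hv => ?_⟩
    have hout : ¬ IsRegularElt ((Quotient.out (ConjClasses.mk ((cmDatum L 3 H).toLocal v ((cmDatum L 3 H).toAdelic γ₀)))).val :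
        GL (Fin 3) (LocalRing L v)) :=
      fun h => hnregv v ((isRegularElt_iff_of_isConj_local L H v (isConj_out_conjClasses_mk _)).2 h)
    have hpt : OrbitalMeasureFamily.atPoint (fun c => if IsRegularElt ((Quotient.out c).val : GL (Fin 3) (LocalRing L v)) then mG v c else mGs v c)
        ((cmDatum L 3 H).toLocal v ((cmDatum L 3 H).toAdelic γ₀)) = (mGs v).atPoint ((cmDatum L 3 H).toLocal v ((cmDatum L 3 H).toAdelic γ₀)) := by
      unfold OrbitalMeasureFamily.atPoint
      simp only [if_neg hout]
    have hZc : IsClosed ((Subgroup.centralizer ({(cmDatum L 3 H).toLocal v ((cmDatum L 3 H).toAdelic γ₀)} : Set ((cmDatum L 3 H).Local v)) :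
        Subgroup ((cmDatum L 3 H).Local v)) : Set ((cmDatum L 3 H).Local v)) := isClosed_coe_centralizer_singleton _
    haveI : LocallyCompactSpace (Subgroup.centralizer ({(cmDatum L 3 H).toLocal v ((cmDatum L 3 H).toAdelic γ₀)} : Set ((cmDatum L 3 H).Local v))) :=
      hZc.isClosedEmbedding_subtypeVal.locallyCompactSpace
    haveI : SecondCountableTopology (Subgroup.centralizer ({(cmDatum L 3 H).toLocal v ((cmDatum L 3 H).toAdelic γ₀)} : Set ((cmDatum L 3 H).Local v))) :=
      TopologicalSpace.Subtype.secondCountableTopology _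
    haveI : SigmaCompactSpace (Subgroup.centralizer ({(cmDatum L 3 H).toLocal v ((cmDatum L 3 H).toAdelic γ₀)} : Set ((cmDatum L 3 H).Local v))) :=
      sigmaCompactSpace_of_locallyCompact_secondCountable
    haveI := htH v
    haveI := htI v
    rw [hpt, hat v]
    exact quotientMeasure_image_mk_eq_one _ (t v) (ν v) (cmLocalIntegralLevel L 3 H v) (isCompact_isOpen_cmLocalIntegralLevel L 3 H v).2
      (hK v) (ht1 v hv)
  · -- FILE A's point data at γ₀
    obtain ⟨hadm, S₀, t, htH, htI, hat, ht1⟩ := hmGs γ₀ (hss γ₀)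
    have hout : ∀ v, ¬ IsRegularElt ((Quotient.out (ConjClasses.mk ((cmDatum L 3 H).toLocal v ((cmDatum L 3 H).toAdelic γ₀)))).val :
        GL (Fin 3) (LocalRing L v)) :=
      fun v h => hnregv v ((isRegularElt_iff_of_isConj_local L H v (isConj_out_conjClasses_mk _)).2 h)
    refine ⟨S₀, t, htH, htI, fun v => ?_, fun v => ?_, ht1⟩
    · have hpt : OrbitalMeasureFamily.atPoint (fun c => if IsRegularElt ((Quotient.out c).val : GL (Fin 3) (LocalRing L v)) then mG v c else mGs v c)
          ((cmDatum L 3 H).toLocal v ((cmDatum L 3 H).toAdelic γ₀)) = (mGs v).atPoint ((cmDatum L 3 H).toLocal v ((cmDatum L 3 H).toAdelic γ₀)) := by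
        unfold OrbitalMeasureFamily.atPoint
        simp only [if_neg (hout v)]
      rw [hpt, hat v]
    · simp only [if_neg (hout v)]
      exact hadm v


/-- **THE PATCHED ARCHIMEDEAN FAMILY ON THE QUASI-SPLIT SIDE `G = U(Φ₃)` AT A NON-REGULAR CLASS** ((ANCHOR-∞q)).  `H` anisotropic (so the non-regular `γ₀` is semisimple), `Φ₃` the quasi-split form; the kit's `mqi` (any)
is patched at the non-regular arch classes of `U(Φ₃)_∞` by ★ `exists_archOrbitalMeasureFamily_of_isSemisimpleElt` (admissible at every arch class through a
SEMISIMPLE rational point of `U(Φ₃)(L⁺)`): (P∞q) agreement at regular classes, and the binder `hadmA` of ★ (SA-st) :146 VERBATIM for `mqi′`, UNCONDITIONALLY: ★ (LR-∞)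
`exists_isStablyConj_and_isConj_arch_of_isConj_arch` at `H₂ := Φ₃` composed with a SEMISIMPLE rational correspondent `γ ↔ γ₀` in `U(Φ₃)(L⁺)`
(★ `exists_corresponds_of_isSemisimpleElt_of_not_isRegularElt`, ★ `corresponds_cmRationalToArch`, ★ `IsStablyConj.isSemisimpleElt_iff`): every arch class of
`U(Φ₃)_∞` corresponding to `γ₀ ⊗ 1` contains `δ ⊗ 1` for a semisimple rational `δ ∈ U(Φ₃)(L⁺)`. [cite: Rogawski1990, §14.2 p. 232; §4.9 p. 54] -/
theorem exists_patchedArchFamily_quasiSplit_of_not_isRegularElt (hanis : ∀ x : Fin 3 → L, hermForm (cmConjRingHom L) H x x = 0 → x = 0)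
    (hH : (H.map (cmConjRingHom L))ᵀ = H) (hdet : H.det ≠ 0)
    [MeasurableSpace (arch (↥(maximalRealSubfield L)) L (IsCMField.complexConj L) 3 (Matrix.of fun i j : Fin 3 => if i.val + j.val + 1 = 3 then (1 : L) else 0))]
    [BorelSpace (arch (↥(maximalRealSubfield L)) L (IsCMField.complexConj L) 3 (Matrix.of fun i j : Fin 3 => if i.val + j.val + 1 = 3 then (1 : L) else 0))]
    [∀ a : arch (↥(maximalRealSubfield L)) L (IsCMField.complexConj L) 3 (Matrix.of fun i j : Fin 3 => if i.val + j.val + 1 = 3 then (1 : L) else 0),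
      MeasurableSpace (arch (↥(maximalRealSubfield L)) L (IsCMField.complexConj L) 3 (Matrix.of fun i j : Fin 3 => if i.val + j.val + 1 = 3 then (1 : L) else 0) ⧸
        Subgroup.centralizer ({a} : Set (arch (↥(maximalRealSubfield L)) L (IsCMField.complexConj L) 3 (Matrix.of fun i j : Fin 3 => if i.val + j.val + 1 = 3 then (1 : L) else 0))))]
    [∀ a : arch (↥(maximalRealSubfield L)) L (IsCMField.complexConj L) 3 (Matrix.of fun i j : Fin 3 => if i.val + j.val + 1 = 3 then (1 : L) else 0),
      BorelSpace (arch (↥(maximalRealSubfield L)) L (IsCMField.complexConj L) 3 (Matrix.of fun i j : Fin 3 => if i.val + j.val + 1 = 3 then (1 : L) else 0) ⧸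
        Subgroup.centralizer ({a} : Set (arch (↥(maximalRealSubfield L)) L (IsCMField.complexConj L) 3 (Matrix.of fun i j : Fin 3 => if i.val + j.val + 1 = 3 then (1 : L) else 0))))]
    (mqi : OrbitalMeasureFamily (arch (↥(maximalRealSubfield L)) L (IsCMField.complexConj L) 3 (Matrix.of fun i j : Fin 3 => if i.val + j.val + 1 = 3 then (1 : L) else 0)))
    (γ₀ : (cmDatum L 3 H).Rational) (hnreg : ¬ IsRegularElt (γ₀.val : GL (Fin 3) L)) :
    ∃ mqi' : OrbitalMeasureFamily (arch (↥(maximalRealSubfield L)) L (IsCMField.complexConj L) 3 (Matrix.of fun i j : Fin 3 => if i.val + j.val + 1 = 3 then (1 : L) else 0)),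
      (∀ c : ConjClasses (arch (↥(maximalRealSubfield L)) L (IsCMField.complexConj L) 3 (Matrix.of fun i j : Fin 3 => if i.val + j.val + 1 = 3 then (1 : L) else 0)),
        IsRegularElt ((Quotient.out c).val : GL (Fin 3) (mixedEmbedding.mixedSpace L)) → mqi' c = mqi c) ∧
      (mqi'.IsAdmissibleOn fun x : arch (↥(maximalRealSubfield L)) L (IsCMField.complexConj L) 3
          (Matrix.of fun i j : Fin 3 => if i.val + j.val + 1 = 3 then (1 : L) else 0) =>
        Corresponds (conjMixed (↥(maximalRealSubfield L)) L (IsCMField.complexConj L)) (archFormOf L 3 H)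
          (archFormOf L 3 (Matrix.of fun i j : Fin 3 => if i.val + j.val + 1 = 3 then (1 : L) else 0)) (cmRationalToArch L 3 H γ₀) x) := by
  classical
  have hnregi : ¬ IsRegularElt ((cmRationalToArch L 3 H γ₀).val : GL (Fin 3) (mixedEmbedding.mixedSpace L)) := by
    intro h
    apply hnreg
    rw [isRegularElt_iff] at h ⊢
    rw [charpoly_cmRationalToArch_eq_map] at h
    exact (Polynomial.separable_map _).1 h
  obtain ⟨mqs, hmqs⟩ := exists_archOrbitalMeasureFamily_of_isSemisimpleElt (L := L)
    (H := (Matrix.of fun i j : Fin 3 => if i.val + j.val + 1 = 3 then (1 : L) else 0))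
    (antidiagOne_isHermitian L 3) (isUnit_antidiagOne_det (L := L) (N := 3)).ne_zero
  -- a SEMISIMPLE rational correspondent `γ ↔ γ₀` in `U(Φ₃)(L⁺)`, non-regular, with its quadratic relation
  have hss₀ : Rogawski1990.IsSemisimpleElt (cmConjRingHom L) H γ₀ := isSemisimpleElt_of_anisotropic (cmConjRingHom L) H hanis γ₀
  obtain ⟨γ, hssγ, hγγ₀⟩ := exists_corresponds_of_isSemisimpleElt_of_not_isRegularElt hH hdet
    (Matrix.of fun i j : Fin 3 => if i.val + j.val + 1 = 3 then (1 : L) else 0) (antidiagOne_isHermitian L 3)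
    (isUnit_antidiagOne_det (L := L) (N := 3)).ne_zero γ₀ hss₀ hnreg
  have hnregγ : ¬ IsRegularElt (γ.val : GL (Fin 3) L) := fun h => hnreg (isRegularElt_of_isConj hγγ₀ h)
  obtain ⟨a, b, hab, -, -, hγab⟩ := exists_ne_mul_sub_eq_zero_of_isSemisimpleElt_of_not_isRegularElt_cm L (antidiagOne_isHermitian L 3)
    (isUnit_antidiagOne_det (L := L) (N := 3)).ne_zero γ hssγ hnregγ
  have hγi := corresponds_cmRationalToArch hγγ₀
  -- ★ (LR-∞) at `H₂ := Φ₃` (B-p14 (g25), p822441), composed with `γ ↔ γ₀` at `∞`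
  have hLRq : ∀ (x : arch (↥(maximalRealSubfield L)) L (IsCMField.complexConj L) 3 (Matrix.of fun i j : Fin 3 => if i.val + j.val + 1 = 3 then (1 : L) else 0)),
      Corresponds (conjMixed (↥(maximalRealSubfield L)) L (IsCMField.complexConj L)) (archFormOf L 3 H)
        (archFormOf L 3 (Matrix.of fun i j : Fin 3 => if i.val + j.val + 1 = 3 then (1 : L) else 0)) (cmRationalToArch L 3 H γ₀) x →
      ∃ δ : (cmDatum L 3 (Matrix.of fun i j : Fin 3 => if i.val + j.val + 1 = 3 then (1 : L) else 0)).Rational,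
        Rogawski1990.IsSemisimpleElt (cmConjRingHom L) (Matrix.of fun i j : Fin 3 => if i.val + j.val + 1 = 3 then (1 : L) else 0) δ ∧
        IsConj (cmRationalToArch L 3 (Matrix.of fun i j : Fin 3 => if i.val + j.val + 1 = 3 then (1 : L) else 0) δ) x := by
    intro x hx
    have hx' : IsConj ((cmRationalToArch L 3 (Matrix.of fun i j : Fin 3 => if i.val + j.val + 1 = 3 then (1 : L) else 0) γ :
          ↥(arch (↥(maximalRealSubfield L)) L (IsCMField.complexConj L) 3 (Matrix.of fun i j : Fin 3 => if i.val + j.val + 1 = 3 then (1 : L) else 0))) :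
        GL (Fin 3) (mixedEmbedding.mixedSpace L)) (x : GL (Fin 3) (mixedEmbedding.mixedSpace L)) :=
      IsConj.trans hγi hx
    obtain ⟨δ, hst, hδ⟩ := exists_isStablyConj_and_isConj_arch_of_isConj_arch (antidiagOne_isHermitian L 3)
      (isUnit_antidiagOne_det (L := L) (N := 3)).ne_zero hab γ hγab x hx'
    exact ⟨δ, hst.isSemisimpleElt_iff.1 hssγ, hδ⟩
  refine ⟨fun c => if IsRegularElt ((Quotient.out c).val : GL (Fin 3) (mixedEmbedding.mixedSpace L)) then mqi c else mqs c,
    fun c hc => if_pos hc, ?_⟩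
  intro c hc
  have hcn : ¬ IsRegularElt ((Quotient.out c).val : GL (Fin 3) (mixedEmbedding.mixedSpace L)) :=
    fun h => hnregi (isRegularElt_of_isConj hc.symm h)
  obtain ⟨δ, hδs, hδ⟩ := hLRq (Quotient.out c) hc
  have hcδ : ConjClasses.mk (cmRationalToArch L 3 (Matrix.of fun i j : Fin 3 => if i.val + j.val + 1 = 3 then (1 : L) else 0) δ) = c := by
    rw [ConjClasses.mk_eq_mk_iff_isConj.2 hδ, ← ConjClasses.quotient_mk_eq_mk, Quotient.out_eq]
  obtain ⟨h0, hinv, -, hfin⟩ := hmqs c ⟨δ, hδs, hcδ⟩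
  simp only [if_neg hcn]
  exact ⟨h0, hinv, hfin⟩

end Literature.NumberTheory.Automorphic.UnitaryGroup
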